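import Summits.ResolutionOfSingularities.ResolutionOfSingularities.Theorems.MarkedTransferCampaignW46TamePersistence
import Literature.AlgebraicGeometry.Resolution.MaximalContactChartTransform
import Literature.AlgebraicGeometry.Resolution.BlowupRestrictOpen
import HarnessLib

/-!
# [OURS · L1 W4.6, rung (iv) «large characteristic», LEVEL 1] TRANSPORT of a maximal-contact hypersurface along a step
# of the TYPED procedure (the typed blow-up datum `π : Z' → Z`, any model): the transform of the contact hypersurface
# is again a contact hypersurface for the transform `E'`, containing `Sing(E')` — Kollár's Def. 3.78 read on typed runs
# (cell res-hironaka, LADDER-RESOLUTION rung L, D-0089; slot W4.6, seat res-L1-s46-pv-7; host route MarkedTransfer,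
# `--supports stmt-ResolutionOfSingularities-16155 --as helper`)

HONEST FRAMING. Nothing here is a statement of H. Hironaka's manuscript (2017-03-23, [Hironaka2017]) and nothing here
asserts that any statement of it holds. OURS corollaries over the shared typed-procedure module
`MarkedTransferCampaignW46TypedProcedure` (res-L1-type-o1: `Step`, `Step.E'`, `Run`; typed CANDIDATE carriers
`AmbientDatum`, `IdealExponent`, `IdealExponent.sing`, `IdealExponent.transform` used as definitions) of the TREE's
BGMW Lemma 3.6.4 (2)–(5) packaged for an arbitrary blow-up model (this seat's
`Literature/…/MaximalContactChartTransform.lean`, `IsBlowup.maxContactChart_transform`) and of the restriction of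
blow-ups / controlled transforms over opens (`BlowupRestrictOpen.lean`). Every characteristic: the TRANSPORT of a
contact hypersurface needs no tameness — tameness (regime (iv), `b < p`) is what CREATES the hypersurface
(`TameMaximalContact`, `TamePersistence`). No premise of the manuscript, no FACT-LIST premise. AI review is weaker
than expert review. No `sorry`, no new definition; axioms standard.

## What this file pins

A **contact chart** for a typed state `(A, E)`, `E = (J, b)`, on an open `U ⊆ Z` is an ideal sheaf `H` on `U` with
`H ⊆ 𝒟^{b-1}(J|_U)` (Kollár's `MC`, for the `K`-structure of `Z`), order-one stalk generators on `V(H)` (a regular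
hypersurface), and — consequently — `Sing(E) ∩ U ⊆ V(H)`. In regime (iv) every point has one
(`TameMaximalContact.exists_isMaxContact_nhd_of_charGT`).

* `Step.contactChart_transport` — for a typed step `s : Step R A'` (blow-up `s.π : Z' → Z` of the centre `D`,
  `D ⊆ ∇(E) ⊆ Sing(E)` regular; ANY model of the blow-up) and a contact chart `H` on `U`: on `U' := s.π⁻¹(U)` the
  weight-one controlled transform `H'` of `H` along the restricted blow-up `s.π|_U : U' → U` (a blow-up of `U` along
  `𝓘_D|_U`) is a contact chart for the transform `E' = (J', b)`: `H' ⊆ 𝒟^{b-1}(J'|_{U'})`, order-one stalk generators,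
  and `Sing(E') ∩ U' ⊆ V(H')` — «`Z_1 ⊂ H_1`» for the next centre, whatever the résumé of `E'` chooses inside
  `Sing(E')`;
* `Step.centre_subset_contactChart` — the current centre lies on the chart: `D ∩ U ⊆ V(H)`.

Iterating along a typed `Run` (all stages, `Run.E_succ`) gives a contact hypersurface on `(π_k ⋯ π_1)⁻¹(U)` at every
stage containing `Sing(E_k)` there — Def. 3.78's «the center of every blow-up `Z_i ⊂ X_i` is contained in the
birational transform `H_i`» for typed runs, the centres being chosen inside `Sing` (`Step.le_idealOrder_of_mem`).

## References (context; nothing is cited as a premise)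

* E. Bierstone, D. Grigoriev, P. Milman, J. Włodarczyk (2011), Lemma 3.6.4 (2)–(5); J. Kollár (2007), Def. 3.78,
  Thm. 3.80 (1) — through this seat's `MaximalContactChartTransform.lean`. [cite: Kollar2007, Def. 3.78]
* U. Görtz, T. Wedhorn, *Algebraic Geometry I*, Prop. 13.91 (blow-ups restrict over opens) — through
  `BlowupRestrictOpen.lean`. [cite: GortzWedhorn2020, Prop. 13.91]
-/

noncomputable section

set_option linter.dupNamespace false -- mandated namespace of this single-conjunct summit

open CategoryTheory AlgebraicGeometry TopologicalSpace IsLocalRing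

namespace Summit.ResolutionOfSingularities.ResolutionOfSingularities.Theorems
namespace CampaignW46

open Literature.AlgebraicGeometry.Resolution
open Literature.AlgebraicGeometry.Hironaka2017.S02Preliminaries
open Scheme.IdealSheafData

universe u

variable {n : ℕ} {p : ℕ} [Fact p.Prime] {K : Type u} [Field K] [CharP K p]
variable {N : Notions.{u} n} {A A' : AmbientDatum p K} {E : IdealExponent A.Z} {R : Resume N A E}

namespace Step

/-- [OURS · L1 W4.6 (iv)] **The current centre lies on every contact chart**: for a typed step `s` and an ideal sheaf
`H` on an open `U ⊆ Z` with `H ⊆ 𝒟^{b-1}(J|_U)` (any `K`-structure `φ` of `U` with finitely presented differentials)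
and `1 ≤ b`: `D ∩ U ⊆ V(H)` — indeed `Sing(E) ∩ U ⊆ V(H)` (BGMW 3.6.4 (2)) and `D ⊆ Sing(E)`
(`Step.le_idealOrder_of_mem`). [cite: BierstoneGrigorievMilmanWlodarczyk2011, Lemma 3.6.4 (2)] -/
theorem centre_subset_contactChart (s : Step R A') {k : Type u} [CommRing k] {U : A.Z.Opens}
    {φ : k →+* Γ((U : Scheme.{u}), ⊤)} (hφ : HasFinitePresentationDifferentials φ) (hb : 1 ≤ E.b)
    {H : (U : Scheme.{u}).IdealSheafData} (hH : H ≤ derivIdealSheafIter φ (E.b - 1) (E.J.comap U.ι))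
    (y : (U : Scheme.{u})) (hy : y.1 ∈ (s.D : Set A.Z)) : y ∈ H.support := by
  have hsub : ((⟨E.J, [], E.b⟩ : MarkedIdeal A.Z).comap U.ι).support ⊆ (H.support : Set U) :=
    MarkedIdeal.support_subset_support_of_le_deriv hφ _ hb hH
  refine hsub ?_
  rw [MarkedIdeal.support_comap_of_isOpenImmersion]
  exact s.le_idealOrder_of_mem hy

/-- [OURS · L1 W4.6 (iv); NOT a statement of the manuscript] **Transport of a contact chart along a typed step**
(BGMW Lemma 3.6.4 (2)–(5), every characteristic, for the typed blow-up datum — any model). Let `s : Step R A'` be a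
step from `(A, E, R)`, `E = (J, b)` with `1 ≤ b`, and `H` a contact chart on an open `U ⊆ Z`: an ideal sheaf with
`H ⊆ 𝒟^{b-1}(J|_U)` for a `K`-structure `φ` of `U` (finitely presented differentials on `U` and along `s.π|_U`) and
order-one stalk generators on `V(H)`. Put `U' := s.π⁻¹(U) ⊆ Z'`, `C := 𝓘_D|_U`, and let `H'` be the weight-one
controlled transform of `H` along the restricted blow-up `s.π|_U : U' → U`. Then: `H' ⊆ 𝒟^{b-1}(J'|_{U'})` for the
transform `E' = (J', b)` (typed `Step.E'`, Def. 2.1) and the induced `K`-structure; `H'` has order-one stalk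
generators on `V(H')`; and `Sing(E') ∩ U' ⊆ V(H')`. [cite: BierstoneGrigorievMilmanWlodarczyk2011, Lemma 3.6.4 (2)–(5)]
[cite: Kollar2007, Def. 3.78] -/
theorem contactChart_transport (s : Step R A') {k : Type u} [CommRing k] {U : A.Z.Opens}
    {φ : k →+* Γ((U : Scheme.{u}), ⊤)} (hφ : HasFinitePresentationDifferentials φ)
    (hφ' : HasFinitePresentationDifferentials ((s.π ∣_ U).appTop.hom.comp φ)) (hb : 1 ≤ E.b)
    {H : (U : Scheme.{u}).IdealSheafData} (hH : H ≤ derivIdealSheafIter φ (E.b - 1) (E.J.comap U.ι))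
    (hreg : ∀ y ∈ H.support, ∃ v : (U : Scheme.{u}).presheaf.stalk y,
      stalkIdeal H y = Ideal.span {v} ∧ v ∉ (maximalIdeal ((U : Scheme.{u}).presheaf.stalk y)) ^ 2) :
    let C : (U : Scheme.{u}).IdealSheafData := (vanishingIdeal s.D).comap U.ι
    let H' : (s.π ⁻¹ᵁ U : Scheme.{u}).IdealSheafData := controlledTransform (s.π ∣_ U) C H 1
    H' ≤ derivIdealSheafIter ((s.π ∣_ U).appTop.hom.comp φ) (E.b - 1) (s.E'.J.comap (s.π ⁻¹ᵁ U).ι) ∧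
      (∀ y' ∈ H'.support, ∃ w : (s.π ⁻¹ᵁ U : Scheme.{u}).presheaf.stalk y',
        stalkIdeal H' y' = Ideal.span {w} ∧
          w ∉ (maximalIdeal ((s.π ⁻¹ᵁ U : Scheme.{u}).presheaf.stalk y')) ^ 2) ∧
      (∀ y' : (s.π ⁻¹ᵁ U : Scheme.{u}), y'.1 ∈ s.E'.sing → y' ∈ H'.support) := by
  intro C H'
  haveI := (ambientZ_std A).1
  haveI := (ambientZ_std A').1
  have hπU : IsBlowup (s.π ∣_ U) C := IsBlowup.morphismRestrict s.π U s.blowup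
  have hXU : Scheme.IsRegular (U : Scheme.{u}) := (ambientZ_std A).2.1.of_isOpenImmersion U.ι
  have hC : Scheme.IsRegular C.subscheme :=
    s.centre.isRegular_subscheme.subscheme_comap_of_isOpenImmersion U.ι
  have hsupp : (C.support : Set U) ⊆ ((⟨E.J.comap U.ι, [], E.b⟩ : MarkedIdeal U)).support := by
    intro y hy
    have hy' : y.1 ∈ (s.D : Set A.Z) := by
      rw [Scheme.IdealSheafData.support_comap] at hy
      simpa [Scheme.IdealSheafData.coe_support_vanishingIdeal] using hy
    have h := s.le_idealOrder_of_mem hy'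
    change y ∈ ((⟨E.J, [], E.b⟩ : MarkedIdeal A.Z).comap U.ι).support
    rw [MarkedIdeal.support_comap_of_isOpenImmersion]
    exact h
  obtain ⟨h1, h2, h3, -⟩ :=
    hπU.maxContactChart_transform hφ hφ' hXU hC (E.J.comap U.ι) hb hsupp hH hreg
  have hJ' : controlledTransform (s.π ∣_ U) C (E.J.comap U.ι) E.b = s.E'.J.comap (s.π ⁻¹ᵁ U).ι :=
    controlledTransform_morphismRestrict s.π U (vanishingIdeal s.D) E.J E.b
  refine ⟨by rw [← hJ']; exact h1, h2, fun y' hy' => h3 ?_⟩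
  -- `y' ∈ cosupp(J'|_{U'}, b)` from `y'.1 ∈ Sing(E')`
  change y' ∈ (⟨controlledTransform (s.π ∣_ U) C (E.J.comap U.ι) E.b, [], E.b⟩ :
    MarkedIdeal (s.π ⁻¹ᵁ U : Scheme.{u})).support
  rw [hJ']
  change y' ∈ ((⟨s.E'.J, [], s.E'.b⟩ : MarkedIdeal A'.Z).comap (s.π ⁻¹ᵁ U).ι).support
  rw [MarkedIdeal.support_comap_of_isOpenImmersion]
  exact hy'

end Step

end CampaignW46
end Summit.ResolutionOfSingularities.ResolutionOfSingularities.Theorems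

end
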